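import Summits.CriticalPhenomena.PercolationContinuityZ3.Theorems.PercNearOneGluingNoHeavyConstsClusterSquareVariance
import HarnessLib

/-!
# The two-copy representation of the cluster square and the closed cuts of an input pair

builds on p205010 (kernel theorem, internal audit signed; external expert review pending)

PAPER-2 track "percolation constants", part (ii), seat `prim-consts-1`, gen 17 (lane index
`run/shared/lean/prim/consts/CONSTANTS.md`, row A19; memo `FROM-prim-consts-1-g17-THREE-COPY-STRUCTURE.md` §0(6)).
Support file for the crux `NoHeavyLowerTail` (stmt-CriticalPhenomena-4575; `--supports`).  Theorems only; no sorries.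

Notation (finite weighted graph, `μ = prodBernoulli w`, vertices `a, b, c`): `X = a|b|c`, `D_a = {a ↮ b, a ↮ c}`, `U = μ(b ↮ c)`,
`u(ω) = μ{b ↮ c off C_a(ω)}` (`Consts.sepOffCluster`), `T = ∫_{D_a} u² dμ` (`Consts.clusterSquare`, gen 15; CSQ is `T ≤ U²`).

* `Consts.setIntegral_sepOff_sq_eq_Pr2W` — **`T = P(C₁ ∈ X, C₁ →_S C₂ ∈ X)`**, `S = S(C₁)` the set revealed by the exploration
  of `C_a(C₁)` (Gladkov's tree of Example 2.5), via the tower property of `ClusterConditioning.condExpV`;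
* `Consts.PrW_posSep_eq`, `isLowerSet_posSep` — the decreasing event "the open pairs of POSITIVE weight do not join `b` to `c`"
  has probability `μ(b ↮ c)` (configurations with a pair of weight zero weigh nothing);
* `Consts.not_mem_of_mem_boundary`, `compl_boundary_mem_posSep` — the positive boundary `∂⁺C_s` of an open cluster is a closed
  cut forcing `{s ↮ t}` for every `t ∉ C_s`;
* **`Consts.exists_closedWitness_of_noClash`** — if no vertex of `C_s(C₁) ∩ C_t(C₁ →_S C₂)` is joined to `C_a(C₁)` by a pair of
  positive weight, then `(∂⁺C_s(C₁), ∂⁺C_t(C₁ →_S C₂))` is a pair of closed witnesses for `{s ↮ t}` disjoint on `S` — the input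
  of the closed-witness decision-tree vdBK inequality (`Consts.ClosedBK.Pr2W_closedWitness_le`); used in
  `…ConstsClusterSquareNDC.lean` to prove CSQ when no double clash occurs.
References: N. Gladkov, arXiv:2408.08457v2 (2024), Lemma 3.1, Example 2.5, Def. 4.2, Thm. 5.2; J. van den Berg, O. Häggström,
J. Kahn, Random Structures Algorithms 29 (2006), §1 p. 8 and §2.1 Lemma 2.4.
-/

noncomputable section

open Classical

namespace Summit.CriticalPhenomena.PercolationContinuityZ3.Theorems

open MeasureTheory Finset Literature.Probability.LatticeModels Literature.Probability.Percolation
open Literature.Probability.Percolation.DecisionTree Literature.Probability.Percolation.BHK2006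
open Literature.Probability.Percolation.TargetExploration Literature.Probability.Percolation.ClusterConditioning

namespace Consts

section General

variable {V : Type*} [Fintype V]

/-! ### Plumbing (`Finset` configurations versus `Set` configurations) -/

/-- Gladkov's weight of a `Finset` configuration is BHK's product weight of its coercion. [folklore] -/
private theorem wtW_univ_eq_weight_ndc (p : Sym2 V → ℝ) (K : Finset (Sym2 V)) :
    wtW Finset.univ p K = weight p (↑K : Set (Sym2 V)) := by
  unfold wtW weight
  refine Finset.prod_congr rfl fun i _ => ?_
  by_cases hi : i ∈ K
  · rw [if_pos hi, if_pos (Finset.mem_coe.2 hi)]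
  · rw [if_neg hi, if_neg (fun h => hi (Finset.mem_coe.1 h))]

/-- A `wtW`-weighted sum over all `Finset` configurations is the `weight`-weighted sum over all `Set` configurations. [folklore] -/
private theorem sum_powerset_univ_eq_sum_set_ndc (p : Sym2 V → ℝ) (Φ : Set (Sym2 V) → ℝ) :
    ∑ K ∈ (Finset.univ : Finset (Sym2 V)).powerset, wtW Finset.univ p K * Φ ↑K = ∑ ω : Set (Sym2 V), weight p ω * Φ ω := by
  rw [Finset.powerset_univ]
  exact Fintype.sum_equiv Fintype.finsetEquivSet _ _ fun K => by
    rw [Fintype.finsetEquivSet_apply, wtW_univ_eq_weight_ndc]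

omit [Fintype V] in
/-- The inverse of `Fintype.finsetEquivSet` on a coerced `Finset`. [folklore] -/
private theorem finsetEquivSet_symm_coe_ndc [Fintype V] (K : Finset (Sym2 V)) :
    (Fintype.finsetEquivSet (α := Sym2 V)).symm (↑K : Set (Sym2 V)) = K :=
  (Fintype.finsetEquivSet (α := Sym2 V)).symm_apply_apply K

/-- The hybrid of coerced `Finset` configurations is the coerced splice along the revealed set. [cite: Gladkov2024, Def. 2.3–2.4] -/
theorem hybrid_coe_splice (v : V) (K C : Finset (Sym2 V)) :
    hybrid v (↑K : Set (Sym2 V)) ↑C = ↑(splice (revealedAt (Finset.univ : Finset (Sym2 V)) (∅ : Finset V) v K) K C) := by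
  simp only [hybrid, finsetEquivSet_symm_coe_ndc]

/-- `∫_S g dμ = Σ_ω weight(ω) g(ω) 1_S(ω)`. [folklore] -/
private theorem setIntegral_eq_sum_ndc (w : Sym2 V → unitInterval) (S : Set (Set (Sym2 V))) (g : Set (Sym2 V) → ℝ) :
    ∫ ω in S, g ω ∂(prodBernoulli w) = ∑ ω : Set (Sym2 V), weight (fun e => (w e : ℝ)) ω * (g ω * ind S ω) := by
  rw [← integral_indicator MeasurableSet.of_discrete, integral_prodBernoulli_eq_sum]
  refine Finset.sum_congr rfl fun ω _ => ?_
  by_cases hω : ω ∈ S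
  · rw [Set.indicator_of_mem hω, ind_of_mem hω, mul_one]
  · rw [Set.indicator_of_notMem hω, ind_of_not_mem hω]; simp

/-! ### The separation event through pairs of positive weight -/

/-- A configuration containing a pair of weight zero has weight zero. [folklore] -/
theorem wtW_eq_zero_of_not_subset_pos (w : Sym2 V → unitInterval) {P : Finset (Sym2 V)}
    (hP : ∀ e, e ∈ P ↔ (0 : ℝ) < w e) {C : Finset (Sym2 V)} (hC : ¬ C ⊆ P) :
    wtW Finset.univ (fun e => (w e : ℝ)) C = 0 := by
  obtain ⟨e, heC, heP⟩ := Finset.not_subset.1 hC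
  unfold wtW
  refine Finset.prod_eq_zero (Finset.mem_univ e) ?_
  rw [if_pos heC]
  have h0 : (0 : ℝ) ≤ w e := (w e).2.1
  have h1 : ¬ (0 : ℝ) < w e := fun h => heP ((hP e).2 h)
  linarith [not_lt.1 h1]

omit [Fintype V] in
/-- The event "the open pairs of positive weight do not join `b` to `c`" is decreasing. [folklore] -/
theorem isLowerSet_posSep (P : Finset (Sym2 V)) (b c : V) :
    IsLowerSet {C : Finset (Sym2 V) | ¬ (openGraph (↑(C ∩ P) : Set (Sym2 V))).Reachable b c} := by
  intro C C' hC' hC h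
  exact hC (h.mono (openGraph_mono (Finset.coe_subset.2 (Finset.inter_subset_inter hC' le_rfl))))

/-- Its probability is `μ(b ↮ c)` (configurations with a pair of weight zero do not count). [folklore] -/
theorem PrW_posSep_eq (w : Sym2 V → unitInterval) {P : Finset (Sym2 V)} (hP : ∀ e, e ∈ P ↔ (0 : ℝ) < w e) (b c : V) :
    PrW Finset.univ (fun e => (w e : ℝ)) {C : Finset (Sym2 V) | ¬ (openGraph (↑(C ∩ P) : Set (Sym2 V))).Reachable b c} =
      (prodBernoulli w).real (openConn b c)ᶜ := by
  rw [prodBernoulli_real_eq_sum_weight_ind, PrW_eq_sum_ind, ← sum_powerset_univ_eq_sum_set_ndc]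
  refine Finset.sum_congr rfl fun C _ => ?_
  by_cases hC : C ⊆ P
  · have hCP : C ∩ P = C := Finset.inter_eq_left.2 hC
    congr 1
    by_cases h : (openGraph (↑C : Set (Sym2 V))).Reachable b c
    · rw [ind_of_not_mem (show C ∉ {C : Finset (Sym2 V) | ¬ (openGraph (↑(C ∩ P) : Set (Sym2 V))).Reachable b c} from
        fun h' => h' (by rwa [hCP])), ind_of_not_mem (show (↑C : Set (Sym2 V)) ∉ (openConn b c)ᶜ from fun h' => h' h)]
    · rw [ind_of_mem (show C ∈ {C : Finset (Sym2 V) | ¬ (openGraph (↑(C ∩ P) : Set (Sym2 V))).Reachable b c} by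
        show ¬ (openGraph (↑(C ∩ P) : Set (Sym2 V))).Reachable b c
        rwa [hCP]), ind_of_mem (show (↑C : Set (Sym2 V)) ∈ (openConn b c)ᶜ from h)]
  · rw [wtW_eq_zero_of_not_subset_pos w hP hC, zero_mul, zero_mul]

/-! ### Closed cuts: the positive boundary of an open cluster -/

/-- The positive-weight pairs leaving the open cluster of `s` are closed. [folklore] -/
theorem not_mem_of_mem_boundary {P : Finset (Sym2 V)} {K : Finset (Sym2 V)} {s : V} {e : Sym2 V}
    (he : e ∈ P.filter fun e => ∃ y z : V, e = s(y, z) ∧ (openGraph (↑K : Set (Sym2 V))).Reachable s y ∧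
      ¬ (openGraph (↑K : Set (Sym2 V))).Reachable s z) :
    e ∉ K := by
  intro heK
  obtain ⟨-, y, z, rfl, hy, hz⟩ := Finset.mem_filter.1 he
  by_cases hyz : y = z
  · exact hz (hyz ▸ hy)
  · exact hz (hy.trans (SimpleGraph.Adj.reachable ((openGraph_adj _ y z).2 ⟨Finset.mem_coe.2 heK, hyz⟩)))

/-- Closing the positive boundary of the cluster of `s` separates `s` from every `t` outside it, whatever the other pairs do.
[folklore] -/
theorem compl_boundary_mem_posSep {P : Finset (Sym2 V)} {K : Finset (Sym2 V)} {s t : V}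
    (ht : ¬ (openGraph (↑K : Set (Sym2 V))).Reachable s t) :
    (P.filter fun e => ∃ y z : V, e = s(y, z) ∧ (openGraph (↑K : Set (Sym2 V))).Reachable s y ∧
        ¬ (openGraph (↑K : Set (Sym2 V))).Reachable s z)ᶜ ∈
      {C : Finset (Sym2 V) | ¬ (openGraph (↑(C ∩ P) : Set (Sym2 V))).Reachable s t} := by
  set I := P.filter fun e => ∃ y z : V, e = s(y, z) ∧ (openGraph (↑K : Set (Sym2 V))).Reachable s y ∧
    ¬ (openGraph (↑K : Set (Sym2 V))).Reachable s z with hI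
  show ¬ (openGraph (↑(Iᶜ ∩ P) : Set (Sym2 V))).Reachable s t
  rintro ⟨p⟩
  obtain ⟨d, -, hd1, hd2⟩ := p.exists_boundary_dart {v | (openGraph (↑K : Set (Sym2 V))).Reachable s v}
    (SimpleGraph.Reachable.refl s) ht
  have hadj := d.adj
  rw [openGraph_adj] at hadj
  obtain ⟨hmem, -⟩ := hadj
  have hmem' : s(d.toProd.1, d.toProd.2) ∈ Iᶜ ∩ P := Finset.mem_coe.1 hmem
  rw [Finset.mem_inter, Finset.mem_compl] at hmem'
  exact hmem'.1 (Finset.mem_filter.2 ⟨hmem'.2, d.toProd.1, d.toProd.2, rfl, hd1, hd2⟩)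

/-! ### The witness pair of an input with no clash -/

/-- **One clash-free witness pair.**  Let `S = S(C₁)` be the set revealed by the exploration of `C_a(C₁)` and `C₃ = C₁ →_S C₂`.  If
`a ↮ s` in `C₁`, `s ↮ t` in `C₁` and in `C₃`, and NO vertex of `C_s(C₁) ∩ C_t(C₃)` is joined to `C_a(C₁)` by a pair of positive weight,
then `I = ∂⁺C_s(C₁)` and `J = ∂⁺C_t(C₃)` (positive boundaries) are closed in `C₁` resp. `C₃`, force `{s ↮ t}`, and are disjoint on `S`.
[cite: Gladkov2024, Def. 4.2 and Example 2.5 (the revealed set of the cluster exploration)] -/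
theorem exists_closedWitness_of_noClash {P : Finset (Sym2 V)} (w : Sym2 V → unitInterval)
    (hP : ∀ e, e ∈ P ↔ (0 : ℝ) < w e) (a s t : V) (K₁ K₂ : Finset (Sym2 V))
    (has : ¬ (openGraph (↑K₁ : Set (Sym2 V))).Reachable a s)
    (hst : ¬ (openGraph (↑K₁ : Set (Sym2 V))).Reachable s t)
    (hst₃ : ¬ (openGraph (↑(splice (revealedAt (Finset.univ : Finset (Sym2 V)) (∅ : Finset V) a K₁) K₁ K₂) :
      Set (Sym2 V))).Reachable s t)
    (hat₃ : ¬ (openGraph (↑K₁ : Set (Sym2 V))).Reachable a t)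
    (hno : ¬ ∃ y k : V, (openGraph (↑K₁ : Set (Sym2 V))).Reachable a k ∧ (0 : ℝ) < w s(k, y) ∧
      (openGraph (↑K₁ : Set (Sym2 V))).Reachable s y ∧
      (openGraph (↑(splice (revealedAt (Finset.univ : Finset (Sym2 V)) (∅ : Finset V) a K₁) K₁ K₂) :
        Set (Sym2 V))).Reachable t y) :
    ∃ I J : Finset (Sym2 V), Disjoint I K₁ ∧
      Iᶜ ∈ {C : Finset (Sym2 V) | ¬ (openGraph (↑(C ∩ P) : Set (Sym2 V))).Reachable s t} ∧
      Disjoint J (splice (revealedAt (Finset.univ : Finset (Sym2 V)) (∅ : Finset V) a K₁) K₁ K₂) ∧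
      Jᶜ ∈ {C : Finset (Sym2 V) | ¬ (openGraph (↑(C ∩ P) : Set (Sym2 V))).Reachable s t} ∧
      ∀ i ∈ I, i ∈ J → i ∉ revealedAt (Finset.univ : Finset (Sym2 V)) (∅ : Finset V) a K₁ := by
  set K₃ := splice (revealedAt (Finset.univ : Finset (Sym2 V)) (∅ : Finset V) a K₁) K₁ K₂ with hK₃
  set I := P.filter fun e => ∃ y z : V, e = s(y, z) ∧ (openGraph (↑K₁ : Set (Sym2 V))).Reachable s y ∧
    ¬ (openGraph (↑K₁ : Set (Sym2 V))).Reachable s z with hI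
  set J := P.filter fun e => ∃ y z : V, e = s(y, z) ∧ (openGraph (↑K₃ : Set (Sym2 V))).Reachable t y ∧
    ¬ (openGraph (↑K₃ : Set (Sym2 V))).Reachable t z with hJ
  have hJmem : Jᶜ ∈ {C : Finset (Sym2 V) | ¬ (openGraph (↑(C ∩ P) : Set (Sym2 V))).Reachable s t} := by
    have h := compl_boundary_mem_posSep (P := P) (K := K₃) (s := t) (t := s) (fun h => hst₃ h.symm)
    exact fun h' => h h'.symm
  refine ⟨I, J, Finset.disjoint_left.2 fun e he => not_mem_of_mem_boundary he, compl_boundary_mem_posSep hst,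
    Finset.disjoint_left.2 fun e he => not_mem_of_mem_boundary he, hJmem, fun i hiI hiJ hiS => ?_⟩
  -- a pair in both boundaries and in the revealed set produces a clash
  obtain ⟨u, hui, hau⟩ := exists_reachable_of_mem_revealedAt hiS
  obtain ⟨hiP, y, z, hi, hy, hz⟩ := Finset.mem_filter.1 hiI
  obtain ⟨-, y', z', hi', hy', hz'⟩ := Finset.mem_filter.1 hiJ
  -- the endpoint joined to `a` is `z` (the other endpoint `y` is joined to `s`)
  have hz₁ : (openGraph (↑K₁ : Set (Sym2 V))).Reachable a z := by
    rw [hi] at hui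
    rcases Sym2.mem_iff.1 hui with h | h
    · exact absurd (hau.trans (h ▸ hy).symm) has
    · exact h ▸ hau
  have hz₃ : (openGraph (↑K₃ : Set (Sym2 V))).Reachable a z := (reachable_hybrid_iff a K₁ K₂ z).2 hz₁
  rcases Sym2.eq_iff.1 (hi.symm.trans hi') with ⟨hyy, -⟩ | ⟨-, hzy⟩
  · -- `y = y'`: `y ∈ C_s(C₁) ∩ C_t(C₃)` is joined to `z ∈ C_a(C₁)` by the positive pair `i`
    refine hno ⟨y, z, hz₁, ?_, hy, ?_⟩
    · have h0 : (0 : ℝ) < w i := (hP i).1 hiP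
      rw [hi, Sym2.eq_swap] at h0
      exact h0
    · rw [hyy]; exact hy'
  · -- `z = y'`: then `t ↔ z ↔ a` in `C₃`, contradicting `a ↮ t`
    have h1 : (openGraph (↑K₃ : Set (Sym2 V))).Reachable t z := by rw [hzy]; exact hy'
    exact hat₃ ((reachable_hybrid_iff a K₁ K₂ t).1 (hz₃.trans h1.symm))

/-! ### The two-copy representation of the cluster square -/

/-- `u` is measurable for the exploration of `C_a`: it takes the same value at every hybrid of `ω`. [cite: Gladkov2024, Lemma 3.1] -/
theorem sepOff_hybrid (w : Sym2 V → unitInterval) (a b c : V) (ω η : Set (Sym2 V)) :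
    (prodBernoulli w).real {η' | ¬ (openGraph (η' \ barOf {a} (setCl (hybrid a ω η) {a}))).Reachable b c} =
      (prodBernoulli w).real {η' | ¬ (openGraph (η' \ barOf {a} (setCl ω {a}))).Reachable b c} := by
  have hcut : cutSet a (hybrid a ω η) = cutSet a ω := by
    ext e
    simp only [cutSet, Set.mem_setOf_eq, reachable_hybrid_iff']
  rw [barOf_setCl_singleton_eq_cutSet, barOf_setCl_singleton_eq_cutSet, hcut]

/-- **`T = P(C₁ ∈ X, C₁ →_S C₂ ∈ X)`** (`S = S(C₁)` revealed by the exploration of `C_a(C₁)`, `X = a|b|c`): the two-copy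
representation of the cluster square `∫_{D_a} u² dμ`. [cite: Gladkov2024, Lemma 3.1 and Thm. 5.2; VandenbergHaggstromKahn2005, §2.1 Lemma 2.4] -/
theorem setIntegral_sepOff_sq_eq_Pr2W (w : Sym2 V → unitInterval) (a b c : V) :
    (∫ ω in (openConn a b)ᶜ ∩ (openConn a c)ᶜ,
        (prodBernoulli w).real {η | ¬ (openGraph (η \ barOf {a} (setCl ω {a}))).Reachable b c} ^ 2 ∂(prodBernoulli w)) =
      Pr2W Finset.univ (fun e => (w e : ℝ))
        {x : Finset (Sym2 V) × Finset (Sym2 V) |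
          (↑x.1 : Set (Sym2 V)) ∈ (openConn a b)ᶜ ∩ (openConn a c)ᶜ ∩ (openConn b c)ᶜ ∧
          (↑(splice (revealedAt (Finset.univ : Finset (Sym2 V)) (∅ : Finset V) a x.1) x.1 x.2) : Set (Sym2 V)) ∈
            (openConn a b)ᶜ ∩ (openConn a c)ᶜ ∩ (openConn b c)ᶜ} := by
  set p : Sym2 V → ℝ := fun e => (w e : ℝ) with hp
  set Da : Set (Set (Sym2 V)) := (openConn a b)ᶜ ∩ (openConn a c)ᶜ with hDa
  set Xs : Set (Set (Sym2 V)) := (openConn a b)ᶜ ∩ (openConn a c)ᶜ ∩ (openConn b c)ᶜ with hXs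
  set u : Set (Sym2 V) → ℝ := fun ω =>
    (prodBernoulli w).real {η | ¬ (openGraph (η \ barOf {a} (setCl ω {a}))).Reachable b c} with hu
  -- (1) the left side as a weighted sum, and `u² 1_{D_a} = E[1_U | 𝓕(C_a)] · (u 1_{D_a})`
  have hDa_hybrid : ∀ ω η : Set (Sym2 V), hybrid a ω η ∈ Da ↔ ω ∈ Da := by
    intro ω η
    simp only [hDa, Set.mem_inter_iff, Set.mem_compl_iff, openConn, Set.mem_setOf_eq, reachable_hybrid_iff']
  have hΨ : ∀ ω η : Set (Sym2 V), u (hybrid a ω η) * ind Da (hybrid a ω η) = u ω * ind Da ω := by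
    intro ω η
    have h1 : u (hybrid a ω η) = u ω := sepOff_hybrid w a b c ω η
    have h2 : ind Da (hybrid a ω η) = ind Da ω := by
      by_cases hω : ω ∈ Da
      · rw [ind_of_mem hω, ind_of_mem ((hDa_hybrid ω η).2 hω)]
      · rw [ind_of_not_mem hω, ind_of_not_mem (fun h => hω ((hDa_hybrid ω η).1 h))]
    rw [h1, h2]
  have hlhs : (∫ ω in Da, u ω ^ 2 ∂(prodBernoulli w)) =
      ∑ ω : Set (Sym2 V), weight p ω * (ind (openConn b c)ᶜ ω * (u ω * ind Da ω)) := by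
    rw [setIntegral_eq_sum_ndc, ← sum_condExpV_mul p a (ind (openConn b c)ᶜ) (fun ω => u ω * ind Da ω) hΨ]
    refine Finset.sum_congr rfl fun ω _ => ?_
    congr 1
    by_cases hω : ω ∈ Da
    · rw [ind_of_mem hω, mul_one, mul_one, condExpV_notConn_eq_of_not_reachable w c hω.1, sq]
    · rw [ind_of_not_mem hω, mul_zero, mul_zero, mul_zero]
  -- (2) the right side: `Σ_{C₁} wtW(C₁) 1_X(C₁) E[1_X | 𝓕(C_a)](C₁)` and `E[1_X | 𝓕] = u` on `X`
  have hX_hybrid : ∀ ω η : Set (Sym2 V), ω ∈ Da → (hybrid a ω η ∈ Xs ↔ hybrid a ω η ∈ (openConn b c)ᶜ) := by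
    intro ω η hω
    have h := (hDa_hybrid ω η).2 hω
    simp only [hXs, Set.mem_inter_iff]
    exact ⟨fun h' => h'.2, fun h' => ⟨h, h'⟩⟩
  have hrhs : Pr2W Finset.univ p {x : Finset (Sym2 V) × Finset (Sym2 V) | (↑x.1 : Set (Sym2 V)) ∈ Xs ∧
      (↑(splice (revealedAt (Finset.univ : Finset (Sym2 V)) (∅ : Finset V) a x.1) x.1 x.2) : Set (Sym2 V)) ∈ Xs} =
      ∑ ω : Set (Sym2 V), weight p ω * (ind Xs ω * condExpV p a (ind Xs) ω) := by
    rw [Pr2W_eq_sum_ind, Finset.sum_product, ← sum_powerset_univ_eq_sum_set_ndc]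
    refine Finset.sum_congr rfl fun K _ => ?_
    rw [condExpV, ← sum_powerset_univ_eq_sum_set_ndc p (fun η => ind Xs (hybrid a ↑K η)), Finset.mul_sum, Finset.mul_sum]
    refine Finset.sum_congr rfl fun C _ => ?_
    rw [hybrid_coe_splice, wt2W]
    have hind : ind {x : Finset (Sym2 V) × Finset (Sym2 V) | (↑x.1 : Set (Sym2 V)) ∈ Xs ∧
        (↑(splice (revealedAt (Finset.univ : Finset (Sym2 V)) (∅ : Finset V) a x.1) x.1 x.2) : Set (Sym2 V)) ∈ Xs} (K, C) =
        ind Xs (↑K : Set (Sym2 V)) *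
          ind Xs (↑(splice (revealedAt (Finset.univ : Finset (Sym2 V)) (∅ : Finset V) a K) K C) : Set (Sym2 V)) := by
      by_cases h1 : (↑K : Set (Sym2 V)) ∈ Xs
      · by_cases h2 : (↑(splice (revealedAt (Finset.univ : Finset (Sym2 V)) (∅ : Finset V) a K) K C) : Set (Sym2 V)) ∈ Xs
        · rw [ind_of_mem h1, ind_of_mem h2, one_mul, ind_of_mem]; exact ⟨h1, h2⟩
        · rw [ind_of_mem h1, ind_of_not_mem h2, one_mul, ind_of_not_mem]; exact fun h => h2 h.2
      · rw [ind_of_not_mem h1, zero_mul, ind_of_not_mem]; exact fun h => h1 h.1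
    rw [hind]; ring
  have hmid : ∀ ω : Set (Sym2 V), ind Xs ω * condExpV p a (ind Xs) ω = ind (openConn b c)ᶜ ω * (u ω * ind Da ω) := by
    intro ω
    by_cases hω : ω ∈ Da
    · have hX : ∀ η, ind Xs (hybrid a ω η) = ind (openConn b c)ᶜ (hybrid a ω η) := by
        intro η
        by_cases h : hybrid a ω η ∈ (openConn b c)ᶜ
        · rw [ind_of_mem h, ind_of_mem ((hX_hybrid ω η hω).2 h)]
        · rw [ind_of_not_mem h, ind_of_not_mem (fun h' => h ((hX_hybrid ω η hω).1 h'))]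
      have hc : condExpV p a (ind Xs) ω = u ω := by
        have hc' : condExpV p a (ind Xs) ω = condExpV p a (ind (openConn b c)ᶜ) ω := by
          unfold condExpV
          exact Finset.sum_congr rfl fun η _ => by rw [hX η]
        rw [hc', condExpV_notConn_eq_of_not_reachable w c hω.1]
      rw [hc, ind_of_mem hω, mul_one]
      by_cases hU : ω ∈ (openConn b c)ᶜ
      · rw [ind_of_mem hU, ind_of_mem (show ω ∈ Xs from ⟨hω, hU⟩)]
      · rw [ind_of_not_mem hU, ind_of_not_mem (show ω ∉ Xs from fun h => hU h.2)]
    · rw [ind_of_not_mem hω, ind_of_not_mem (show ω ∉ Xs from fun h => hω h.1), mul_zero, mul_zero, zero_mul]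
  rw [hlhs, hrhs]
  exact Finset.sum_congr rfl fun ω _ => by rw [hmid]


end General

end Consts

end Summit.CriticalPhenomena.PercolationContinuityZ3.Theorems
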